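/-
Copyright: cell pub-balaban-gaps (YM BLITZ Y1, track G1), seat g1-p2 GEN 8 (unit `pub-balaban-gaps-g1-p2`).  Row (D4) NODE O,
JUNCTION J-3 (multi-level) — THE GREEN FUNCTION ITSELF: for a bond field `U` in the (3.37) window on [4]'s nested family, the inverse
`(Δ_W(U) + L^{2k}·covAvgOp(U, Γ))⁻¹` of the COVARIANT multi-level operator (fundamental representation, print units: `Δ^U + Σ_j
a_j(L^jη)^{−2}Q_j(U)*1_{Λ_j}Q_j(U)`) IS a block walk expansion with Cor. 3.5's letters — 83's expansion of `(W ⊗ 1)(1 − V(W ⊗ 1))⁻¹` plus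
80's kernel identity, whose invertibility hypothesis is DISCHARGED here from the letters, the cube row sum and the margin (79's
`isUnit_covShiftWAv_of_letters`, `ℓ^∞`-Neumann).  HONEST FRAMING: `U` is a hypothesis SHAPE (NOT `e^{iηA′}` from (3.35)–(3.36)); the flat
operator is the lineage's scalar model ⊗ 1_F; (D4) NOT discharged (instance 0∕1); NOT BetaPertH, NOT continuum, NOT Clay.
-/
import Summits.QuantumFields.BalabanUV.Gaps.D4WalkBlockCovariantBondFieldMultiLevel

/-!
# `Gaps.D4WalkBlockCovariantGreenMultiLevel` — the Green function of the covariant multi-level operator of a bond field in the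
# (3.37) window is a block walk expansion, unconditionally (cell pub-balaban-gaps, seat g1-p2 gen 8)

HONEST DEPENDENCY (cell pub-balaban, verbatim): continuum YM on T⁴ ⇐ BetaPertH ∧ nine spine estimates (0/9 proved);
BetaPertH ⇐ (D1) ∧ (D4) ∧ CAP+tail.

* **`blockWalkExpansion_covariantGreen_multiLevelTorus`** — ∃ `δ₁, C, M₀, N₀` (functions of `d, ℓ`, weight windows) such that for every
  admissible `(k, M_h, R, P, D, a, c, Kc)`, finite fibre, holomorphic bond field `U` with inverses in the (3.37) window (bond `α₀L^{−lev y}`,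
  derivative `α₁L^{−2lev x}`), contour system `Γ` inside the `lev`-blocks (`|Γ x| ≤ (d+1)L^{lev x}`), cube row sum `(μ, c_μ)`, `2μ ≤ ε`,
  `2μ ≤ δ₁ − ε − μ`, margin `q < 1` (83's):  `u ↦ (Δ_W(U)(u) + L^{2k}·covAvgOp(U,Γ)(u))⁻¹` is a block walk expansion at
  `(ε − 2μ, δ₁ − ε − 3μ, c_μC(1·(1−q)⁻¹)c_μ, δ₁ − 2μ)` with the relative letters `covBW δ₁ L`, dominating distances — [B9] Cor. 3.5 for the
  covariant multi-level operator of print's (2.13)–(2.14)∕(3.78) on the nested family, constants uniform in `k`, the torus, `{Ω_j}`, `F`, `Γ`.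
WHAT IT IS NOT.  `U = e^{iηA′}` from (3.35)–(3.36) (D-O2-3a); the adjoint representation; (D4) instance 0∕1; words of row (D4) UNCHANGED.

References: T. Bałaban, Comm. Math. Phys. **99** (1985) 389–434 [B9], (3.37) p. 396, (3.50) p. 400, (3.62)–(3.64) p. 402, (3.78) p. 406,
Cor. 3.5 p. 407; Comm. Math. Phys. **96** (1984) [4], (2.13)–(2.14) p. 225, Prop. 2.2 (2.67) p. 234.
-/

noncomputable section

namespace Summit.QuantumFields.BalabanUV.Gaps.D4WalkBlockCovariantGreenMultiLevel

open Metric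
open scoped Matrix
open Literature.MathematicalPhysics.QuantumFieldTheory.Balaban1983to89
open Literature.MathematicalPhysics.QuantumFieldTheory.Balaban1983to89.B4Reflection242 (boxDom blk)
open Literature.MathematicalPhysics.QuantumFieldTheory.Balaban1983to89.B9SectDWalk (DomBy)
open Literature.MathematicalPhysics.QuantumFieldTheory.Balaban1983to89.B9Thm34Ext (toB6)
open Literature.MathematicalPhysics.QuantumFieldTheory.Balaban1983to89.B9Thm37GlueTorus (torusGeom tdist1)
open Literature.MathematicalPhysics.QuantumFieldTheory.Balaban1983to89.TreeLengthTorus (TPt)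
open Literature.MathematicalPhysics.QuantumFieldTheory.Balaban1983to89.B5TorusCover (UT)
open Literature.MathematicalPhysics.QuantumFieldTheory.Balaban1983to89.B11SectG (RowSum)
open Literature.MathematicalPhysics.QuantumFieldTheory.Balaban1983to89.B6MultiLevelBoxOperator (N0)
open Literature.MathematicalPhysics.QuantumFieldTheory.Balaban1983to89.B6MultiLevelTorusOperator (TDomains gmlT tshift unitVec)
open Literature.MathematicalPhysics.QuantumFieldTheory.Balaban1983to89.B6Ineq243TwoLevelBox (aNext)
open Summit.QuantumFields.BalabanUV.Gaps.D4WalkBlock (blockNorm BlockWalkExpansion)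
open Summit.QuantumFields.BalabanUV.Gaps.D4WalkBlockMultiLevelGeometry (cubeML)
open Summit.QuantumFields.BalabanUV.Gaps.D4WalkBlockShiftAlgebra (covShift)
open Summit.QuantumFields.BalabanUV.Gaps.D4WalkBlockShiftStep (covLap)
open Summit.QuantumFields.BalabanUV.Gaps.D4WalkBlockShiftWeighted (wOp covDopW covBW covAlphaW)
open Summit.QuantumFields.BalabanUV.Gaps.D4WalkBlockShiftWeightedAv (blockWalkExpansion_covShiftWAv_of_letters
  isUnit_covShiftWAv_of_letters)
open Summit.QuantumFields.BalabanUV.Gaps.D4WalkBlockCovariantShiftMultiLevel (tdist1_cubeML_tshift_symm_unitVec_le_one)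
open Summit.QuantumFields.BalabanUV.Gaps.D4WalkBlockWeightedLettersMultiLevel (levW levW_pos levW_le_mul_tshift_symm
  weightedLetters_multiLevelTorus)
open Summit.QuantumFields.BalabanUV.Gaps.D4WalkBlockCovariantAveragingMultiLevel (covAvgOp avCorr avCorr_local avCorr_rowSum_le
  avCorr_holo covariantAvg_kernel_eq_multiLevel)
open Summit.QuantumFields.BalabanUV.Gaps.D4WalkBlockCovariantContourMultiLevel (contourT contourTi contour_window_multiLevel
  contourT_holo contourTi_holo)
open Summit.QuantumFields.BalabanUV.Gaps.D4WalkBlockBondFieldWeighted (bondDefect_holo)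
open Summit.QuantumFields.BalabanUV.Gaps.D4WalkBlockCovariantBondFieldMultiLevel (bondWindow_fwd bondWindow_bwd bondWindow_div
  contourBondWindow)

variable {d : ℕ}

section Green

variable {dd N' : ℕ} {E : Type*} [NormedAddCommGroup E] [NormedSpace ℂ E]

/-- **[B9] COR. 3.5 FOR THE GREEN FUNCTION OF THE COVARIANT MULTI-LEVEL OPERATOR OF A BOND FIELD IN THE (3.37) WINDOW, ON THE GENUINE
NESTED FAMILY — UNCONDITIONAL IN THE INVERTIBILITY.**  Hypotheses as `D4WalkBlockCovariantBondFieldMultiLevel.blockWalkExpansion_bondField_multiLevelTorus`;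
conclusion for the kernel `u ↦ (Δ_W(U)(u) + L^{2k}·covAvgOp(U,Γ)(u))⁻¹` itself: the expansion of `(W ⊗ 1)(1 − V(u)(W ⊗ 1))⁻¹` (79's
generic step fed with 78a's weighted letters and §2-of-83's derived windows), `1 − V(u)(W ⊗ 1)` invertible on the ball by
`isUnit_covShiftWAv_of_letters`, and 80's kernel identity.
[cite: Balaban1985BackgroundPropagators, Cor. 3.5 p.407, (3.62)–(3.64) p.402, (3.78) p.406, (3.37) p.396; Balaban1984PropagatorsII, (2.13)–(2.14) p.225, Prop. 2.2 (2.67) p.234; Balaban1988RG2Cluster, (1.11) p.5] -/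
theorem blockWalkExpansion_covariantGreen_multiLevelTorus (d ℓ : ℕ) (hℓ : 1 ≤ ℓ) (aminus aplus a2minus a2plus : ℝ)
    (ha : 0 < aminus) (ha2 : 0 < a2minus) :
    ∃ δ₁ C M₀ : ℝ, ∃ N₀ : ℕ, 0 < δ₁ ∧ 0 < C ∧ 0 < M₀ ∧ 0 < N₀ ∧
      ∀ (k Mh R : ℕ), 3 ≤ Mh → M₀ ≤ ((ℓ : ℝ) + 1) * Mh → 2 * (ℓ + 1) ≤ R → N₀ + 1 ≤ R * ((ℓ + 1) * Mh) →
      ∀ (P : Fin (d + 1) → ℕ) (hP : ∀ μ, 1 ≤ P μ) (hP4 : ∀ μ, 4 ≤ P μ) (D : TDomains d ℓ Mh k P R) (a c : ℕ → ℝ),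
        (∀ i, 1 ≤ i → aminus ≤ a i ∧ a i ≤ aplus) → (∀ i, 1 ≤ i → a2minus ≤ c i ∧ c i ≤ a2plus) →
        (∀ i, 1 ≤ i → a (i + 1) = aNext ℓ (a i) (c i)) →
      ∀ (Kc : Fin (d + 1) → ℕ) [∀ i, NeZero (Kc i)], (∀ i, N0 ℓ Mh k P i = (ℓ + 1) ^ k * Kc i) →
      ∀ (F : Type) [Fintype F] [DecidableEq F] (c₀ : B13.Consts) (Xs : Finset (UT Kc)) (Rb : ℝ)
        (U Ui : Fin (d + 1) → E → ↥(boxDom (N0 ℓ Mh k P)) → Matrix F F ℂ)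
        (Γ : ↥(boxDom (N0 ℓ Mh k P)) → List (↥(boxDom (N0 ℓ Mh k P)) × Fin (d + 1))) (α₀ α₁ ε μ cμ : ℝ),
      (∀ ν y a' b, DifferentiableOn ℂ (fun u => U ν u y a' b) (ball (0 : E) Rb)) →
      (∀ ν y a' b, DifferentiableOn ℂ (fun u => Ui ν u y a' b) (ball (0 : E) Rb)) →
      (∀ ν u y, U ν u y * Ui ν u y = 1) → 0 ≤ α₀ → 0 ≤ α₁ →
      (∀ ν, ∀ u ∈ ball (0 : E) Rb, ∀ y a', ∑ b, ‖(U ν u y - 1) a' b‖ ≤ α₀ * ((((ℓ : ℝ) + 1) ^ D.lev y.1))⁻¹) →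
      (∀ ν, ∀ u ∈ ball (0 : E) Rb, ∀ y a', ∑ b, ‖(Ui ν u y - 1) a' b‖ ≤ α₀ * ((((ℓ : ℝ) + 1) ^ D.lev y.1))⁻¹) →
      (∀ ν, ∀ u ∈ ball (0 : E) Rb, ∀ x a', ∑ b, ‖(U ν u x - U ν u ((tshift (N0 ℓ Mh k P) (unitVec ν)).symm x)) a' b‖ ≤
        α₁ * ((((ℓ : ℝ) + 1) ^ D.lev x.1))⁻¹ ^ 2) →
      (∀ x, (Γ x).length ≤ (d + 1) * (ℓ + 1) ^ D.lev x.1) →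
      (∀ x, ∀ b ∈ Γ x, blk ((ℓ + 1) ^ D.lev x.1) b.1.1 = blk ((ℓ + 1) ^ D.lev x.1) x.1) →
      0 ≤ μ → 2 * μ ≤ ε → 2 * μ ≤ δ₁ - ε - μ → 0 ≤ cμ →
      RowSum (toB6 (torusGeom Kc 0 0 0) 0 True) μ cμ →
      cμ * (cμ * 1 * (1 * ((0 + ∑ j : Unit ⊕ (Fin (d + 1) ⊕ Fin (d + 1)),
        covAlphaW (((ℓ : ℝ) + 1) * α₀) (((d : ℝ) + 1) * (α₁ + (((ℓ : ℝ) + 1) * α₀) ^ 2) +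
          aplus * (Real.exp (2 * ((d : ℝ) + 1) * α₀) - 1)) j * covBW δ₁ ((ℓ : ℝ) + 1) j) * C)) * cμ) * cμ < 1 →
      ∃ (W : Type) (T : W → (TPt dd N' → ℂ) → E → Matrix (↥(boxDom (N0 ℓ Mh k P)) × F) (↥(boxDom (N0 ℓ Mh k P)) × F) ℂ)
        (SX' : Set W) (A' : W → ℝ) (D' : W → UT Kc → UT Kc → ℝ),
        BlockWalkExpansion c₀ (fun q : ↥(boxDom (N0 ℓ Mh k P)) × F => cubeML ℓ k Kc q.1.1)
          (fun q : ↥(boxDom (N0 ℓ Mh k P)) × F => cubeML ℓ k Kc q.1.1)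
          (fun (_ : TPt dd N' → ℂ) u =>
            (covLap ↥(boxDom (N0 ℓ Mh k P)) F (fun ν => tshift (N0 ℓ Mh k P) (unitVec ν)) ((((ℓ : ℝ) + 1) ^ k)⁻¹)
                (fun ν u x => U ν u x - 1) (fun ν u x => Ui ν u ((tshift (N0 ℓ Mh k P) (unitVec ν)).symm x) - 1) u +
              (((ℓ : ℂ) + 1) ^ (2 * k) : ℂ) • covAvgOp D a (contourT Γ fun u b => U b.2 u b.1) (contourTi Γ fun u b => Ui b.2 u b.1) u)⁻¹)
          Xs Rb (ε - 2 * μ) (δ₁ - ε - μ - 2 * μ)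
          (cμ * C * (1 * (1 - cμ * (cμ * 1 * (1 * ((0 + ∑ j : Unit ⊕ (Fin (d + 1) ⊕ Fin (d + 1)),
            covAlphaW (((ℓ : ℝ) + 1) * α₀) (((d : ℝ) + 1) * (α₁ + (((ℓ : ℝ) + 1) * α₀) ^ 2) +
              aplus * (Real.exp (2 * ((d : ℝ) + 1) * α₀) - 1)) j * covBW δ₁ ((ℓ : ℝ) + 1) j) * C)) * cμ) * cμ)⁻¹) * cμ)
          T SX' A' D' (δ₁ - 2 * μ) ∧
        (∀ (j : Unit ⊕ (Fin (d + 1) ⊕ Fin (d + 1))) ω (σ : TPt dd N' → ℂ), (∀ i, ‖σ i‖ ≤ Real.exp c₀.κ₁) →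
          ∀ u ∈ ball (0 : E) Rb, ∀ Y Y',
          blockNorm (fun q : ↥(boxDom (N0 ℓ Mh k P)) × F => cubeML ℓ k Kc q.1.1)
              (fun q : ↥(boxDom (N0 ℓ Mh k P)) × F => cubeML ℓ k Kc q.1.1)
              (covDopW ↥(boxDom (N0 ℓ Mh k P)) F (fun ν => tshift (N0 ℓ Mh k P) (unitVec ν)) ((((ℓ : ℝ) + 1) ^ k)⁻¹) (levW D) j *
                T ω σ u) Y Y' ≤
            covBW (ι := Fin (d + 1)) δ₁ ((ℓ : ℝ) + 1) j * (A' ω * Real.exp (-((δ₁ - 2 * μ) * D' ω Y Y')))) ∧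
        ∀ ω, DomBy (toB6 (torusGeom Kc 0 0 0) 0 True) (D' ω) := by
  obtain ⟨δ₁, C, M₀, N₀, hδ₁, hC, hM₀, hN₀, hlet⟩ := weightedLetters_multiLevelTorus d ℓ hℓ aminus aplus a2minus a2plus ha ha2
  refine ⟨δ₁, C, M₀, N₀, hδ₁, hC, hM₀, hN₀, ?_⟩
  intro k Mh R hMh hM hR hRM P hP hP4 D a c haw hcw hac Kc _ hKc F _ _ c₀ Xs Rb U Ui Γ α₀ α₁ ε μ cμ hUh hUih hinv hα₀ hα₁ hU0 hUi0
    hU1 hlen hblkΓ hμ hμε hμκ hcμ hrow hq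
  have hl := hlet k Mh R hMh hM hR hRM P hP hP4 D a c haw hcw hac Kc hKc F
  have hMh1 : 1 ≤ Mh := le_trans (by norm_num) hMh
  have hR1 : 1 ≤ R := le_trans (by omega) hR
  have hη : (0 : ℝ) < (((ℓ : ℝ) + 1) ^ k)⁻¹ := by positivity
  have hL0 : (0 : ℝ) ≤ (ℓ : ℝ) + 1 := by positivity
  have haw0 : ∀ i, 1 ≤ i → 0 ≤ a i ∧ a i ≤ aplus := fun i hi => ⟨by obtain ⟨h1, _⟩ := haw i hi; linarith, (haw i hi).2⟩
  have haj : ∀ j, 1 ≤ j → 0 < a j := fun j hj => by obtain ⟨h1, _⟩ := haw j hj; linarith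
  have haplus : 0 ≤ aplus := by obtain ⟨h1, h2⟩ := haw 1 le_rfl; linarith
  have hαT : 0 ≤ Real.exp (2 * ((d : ℝ) + 1) * α₀) - 1 := by
    have : (1 : ℝ) ≤ Real.exp (2 * ((d : ℝ) + 1) * α₀) := Real.one_le_exp (by positivity)
    linarith
  have hsh : ∀ ν (x : ↥(boxDom (N0 ℓ Mh k P))), tdist1 Kc ((fun x : ↥(boxDom (N0 ℓ Mh k P)) => cubeML ℓ k Kc x.1)
      ((tshift (N0 ℓ Mh k P) (unitVec ν)).symm x)) ((fun x : ↥(boxDom (N0 ℓ Mh k P)) => cubeML ℓ k Kc x.1) x) ≤ 1 :=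
    fun ν x => tdist1_cubeML_tshift_symm_unitVec_le_one hKc ν x
  have hwr : ∀ ν (x : ↥(boxDom (N0 ℓ Mh k P))), levW D x ≤ ((ℓ : ℝ) + 1) * levW D ((tshift (N0 ℓ Mh k P) (unitVec ν)).symm x) :=
    fun ν x => levW_le_mul_tshift_symm (D := D) hR1 hMh1 ν x
  -- the data of 79's generic step, assembled
  have hWp := bondWindow_fwd (D := D) (U := U) hα₀ hU0
  have hWm := bondWindow_bwd (D := D) (Ui := Ui) hR1 hMh1 hP hα₀ hUi0
  have hdiv := bondWindow_div (D := D) hR1 hMh1 hP hα₀ hinv hU0 hUi0 hU1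
  have hT := contour_window_multiLevel (D := D) (Γ := Γ) (Ub := fun u b => U b.2 u b.1) (Ubi := fun u b => Ui b.2 u b.1) hα₀ hlen
    (contourBondWindow (D := D) hblkΓ hU0) (contourBondWindow (D := D) hblkΓ hUi0)
  have hTgh := contourT_holo (Γ := Γ) (Ub := fun u b => U b.2 u b.1) (Rb := Rb) fun b c c' => hUh b.2 b.1 c c'
  have hTgih := contourTi_holo (Γ := Γ) (Ubi := fun u b => Ui b.2 u b.1) (Rb := Rb) fun b c c' => hUih b.2 b.1 c c'
  have hWph : ∀ ν x a' b, DifferentiableOn ℂ (fun u => (fun ν u x => U ν u x - 1) ν u x a' b) (ball (0 : E) Rb) :=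
    fun ν x a' b => bondDefect_holo (U := fun u => U ν u x) (hUh ν x) a' b
  have hWmh : ∀ ν x a' b, DifferentiableOn ℂ
      (fun u => (fun ν u x => Ui ν u ((tshift (N0 ℓ Mh k P) (unitVec ν)).symm x) - 1) ν u x a' b) (ball (0 : E) Rb) :=
    fun ν x a' b => bondDefect_holo (U := fun u => Ui ν u ((tshift (N0 ℓ Mh k P) (unitVec ν)).symm x)) (hUih ν _) a' b
  obtain ⟨W, T, SX', A', D', hE, hlet', hDom⟩ := blockWalkExpansion_covShiftWAv_of_letters (X := ↥(boxDom (N0 ℓ Mh k P))) (F := F)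
    (E := E) (dd := dd) (N' := N') (sh := fun ν => tshift (N0 ℓ Mh k P) (unitVec ν)) (η := (((ℓ : ℝ) + 1) ^ k)⁻¹) (w := levW D)
    (fun x : ↥(boxDom (N0 ℓ Mh k P)) => cubeML ℓ k Kc x.1) hη (fun x => levW_pos (D := D) x) hL0 hsh hwr _ hC.le hδ₁.le
    (fun Y Y' => (hl Y Y').1) (fun Y Y' => (hl Y Y').2.1) (fun ν Y Y' => (hl Y Y').2.2 ν) c₀ Xs Rb (fun ν u x => U ν u x - 1)
    (fun ν u x => Ui ν u ((tshift (N0 ℓ Mh k P) (unitVec ν)).symm x) - 1)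
    (avCorr D a (contourT Γ fun u b => U b.2 u b.1) (contourTi Γ fun u b => Ui b.2 u b.1))
    (((ℓ : ℝ) + 1) * α₀) (((d : ℝ) + 1) * (α₁ + (((ℓ : ℝ) + 1) * α₀) ^ 2)) (aplus * (Real.exp (2 * ((d : ℝ) + 1) * α₀) - 1)) ε μ cμ
    hWph hWmh (avCorr_holo hTgh hTgih) (by positivity) (by positivity) (mul_nonneg haplus hαT) hWp hWm hdiv
    (fun u p q h => avCorr_local (Kc := Kc) u p q h) (avCorr_rowSum_le haw0 hαT hT) hμ hμε hμκ hcμ hrow hq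
  refine ⟨W, T, SX', A', D', hE.congrK (fun σ u _ hu => ?_), hlet', hDom⟩
  -- invertibility from the letters, then 80's identity with the empty slot
  have hunit := isUnit_covShiftWAv_of_letters (sh := fun ν => tshift (N0 ℓ Mh k P) (unitVec ν)) (η := (((ℓ : ℝ) + 1) ^ k)⁻¹)
    (w := levW D) (fun x : ↥(boxDom (N0 ℓ Mh k P)) => cubeML ℓ k Kc x.1) hη (fun x => levW_pos (D := D) x) hL0 hsh hwr _ hC.le
    hδ₁.le (fun Y Y' => (hl Y Y').2.1) (fun ν Y Y' => (hl Y Y').2.2 ν) Rb (fun ν u x => U ν u x - 1)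
    (fun ν u x => Ui ν u ((tshift (N0 ℓ Mh k P) (unitVec ν)).symm x) - 1)
    (avCorr D a (contourT Γ fun u b => U b.2 u b.1) (contourTi Γ fun u b => Ui b.2 u b.1))
    (α := ((ℓ : ℝ) + 1) * α₀) (α' := ((d : ℝ) + 1) * (α₁ + (((ℓ : ℝ) + 1) * α₀) ^ 2))
    (αav := aplus * (Real.exp (2 * ((d : ℝ) + 1) * α₀) - 1)) (by positivity) (by positivity) (mul_nonneg haplus hαT) hWp hWm hdiv
    (fun u p q h => avCorr_local (Kc := Kc) u p q h) (avCorr_rowSum_le haw0 hαT hT) (by linarith) hcμ hrow hq u hu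
  have h := covariantAvg_kernel_eq_multiLevel (F := F) hMh1 hP D haj (fun ν u x => U ν u x - 1)
    (fun ν u x => Ui ν u ((tshift (N0 ℓ Mh k P) (unitVec ν)).symm x) - 1) (contourT Γ fun u b => U b.2 u b.1)
    (contourTi Γ fun u b => Ui b.2 u b.1) 0 u (by rw [add_zero]; exact hunit)
  rw [add_zero, sub_zero] at h
  exact h.symm

end Green

end Summit.QuantumFields.BalabanUV.Gaps.D4WalkBlockCovariantGreenMultiLevel

end
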